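import Summits.QuantumFields.BalabanUV.Beta.SecondOrderStepLaw

/-!
# `BalabanUV.Beta.SecondOrderStepLawGen` — binder row D1, (N7b-prep) of the second-order hR slot port: **THE LEVEL STEP, ASSEMBLED, FOR AN ARBITRARY
# CONTACT-GENERATOR FAMILY** — `SecondOrderStepLaw.quarticStep_bref_of_laws` (an2 gen 18) with the comb's generator symbol `ctGen d α L` GENERALISED to
# any family `cg κ u : (Fin (d+1) → ℤ) → Fib d → ℝ` (β sub-cell, BINDER-OWNERS row D1 OWNER `b2b-balaban-beta-an2`, gen 31; memo `gen30/N7-SCOPE.v1.md` §4)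

HONEST FRAMING (cell charter, verbatim): «discharging BetaPertH makes Bałaban's UV stability UNCONDITIONAL — a real constructive-QFT result; it is
NOT the continuum limit and NOT the Clay problem.»  HONEST DEPENDENCY: continuum YM on T⁴ ⇐ BetaPertH ∧ nine spine estimates (0/9 proved); BetaPertH
⇐ (D1) ∧ (D4) ∧ CAP+tail; G-an2-4 gates asym, D1 and NE2/3/4.  DERIVED cell leaf: NEUTRAL entrywise kernel algebra ([folklore]) — the proof of
`quarticStep_bref_of_laws` VERBATIM (by fibre blocks: `conjW_diag_apply`, `conjV_diagK_apply`, the `mm`-read's vanishing off the field block), which never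
looks inside the generator symbol; no statement of Bałaban's papers, no `[cite:]`, no `def`, no `Prop` fact; instantiates no binder of the wall.
NOT D1, NOT `BetaPertH`, NOT continuum, NOT Clay.

WHY.  The (0.4)-symmetrised literal's reflection letters carry the BORDER-READING generator `ctGenM d (bhK Lc + Dsh) α Lc` of an2-g28's
`E3ContactGenerator` (it reads the shifted spread's own border; at the rooted border it is the comb's `ctGen`, `ctGenM_bhKAt`), and the evaluated
second-order step law for the literal's resolvents (`SecondOrderStepEvalSym.mmRead_K3OfK_Gsym_bref_of_law`, this gen) delivers coarse symbols
`(γ/(σ·Lc^{d+1})) · ctGenM …`.  The assembly of the next second-order table `T := a • Q + b • B` from that law, the border letter and the units locks is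
symbol-agnostic; this file records it once for every `cg`, so that (N7b)'s level step for `RecursiveWSlot.T2RecOf` at the literal is a one-line
instantiation.  The comb's theorem is the instance `cg := ctGen d α L` (closing `example`).
Provenance: β sub-cell, unit beta-an2 gen 31, 2026-08-21 (v1); statement and proof = `SecondOrderStepLaw` §Step (an2 gen 18) with `ctGen d α L ↦ cg`;
no existing file touched.
-/

open Finset
open scoped BigOperators
open Literature.MathematicalPhysics.QuantumFieldTheory.Balaban1983to89
open Literature.MathematicalPhysics.QuantumFieldTheory.Balaban1983to89.Beta
open ExpKernelCalculus (MKer)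
open PolarizationSign (reflSign)
open KernelReflection (refK refK_apply)
open ResolventReflection (bref Φ)
open OneStepResolventKernel (Fib)
open BalabanStepJetsSucc (mmRead mmRead_inr_left mmRead_inr_right)
open Summit.QuantumFields.BalabanUV.Beta.ChartConjugation (conjV conjW conjW₁ conjW₂)
open Summit.QuantumFields.BalabanUV.Beta.BorderedHessian (diagK ctGen conjV_diagK_apply)
open Summit.QuantumFields.BalabanUV.Beta.SecondOrderStepLaw (conjW_diag_apply quarticStep_bref_of_laws)

namespace Summit.QuantumFields.BalabanUV.Beta.SecondOrderStepLawGen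

noncomputable section

variable {d : ℕ}

section StepGen

variable {N L : ℕ} {𝕄 G : MKer (d + 1) (Fib d)} {w a aE b κ₁ γ' : ℝ} {α : Fin (d + 1)}
  {cg : Fin (d + 1) → (Fin (d + 1) → ℤ) → (Fin (d + 1) → ℤ) → Fib d → ℝ}
  {Q₀ R₀ B RB : Fin (d + 1) → (Fin (d + 1) → ℤ) → Fin (d + 1) → (Fin (d + 1) → ℤ) → MKer (d + 1) (Fib d)}
  {E₀ Vbd : Fin (d + 1) → (Fin (d + 1) → ℤ) → MKer (d + 1) (Fib d)}
  {hh hB : Fin (d + 1) → (Fin (d + 1) → ℤ) → Fin (d + 1) → (Fin (d + 1) → ℤ) → (Fin (d + 1) → ℤ) → Fib d → ℝ}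

/-- [folklore] **THE LEVEL STEP, ASSEMBLED, FOR AN ARBITRARY GENERATOR FAMILY `cg`** — `SecondOrderStepLaw.quarticStep_bref_of_laws` with the comb's
generator `ctGen d α L κ u` replaced by any symbol family `cg κ u` (the proof is entrywise by fibre blocks and never looks inside the symbol); see that
file's module docstring for the reading of every letter.  For the (0.4) literal: `cg := ctGenM d (bhK Lc + Dsh) α Lc` (an2-g28 `E3ContactGenerator`). -/
theorem quarticStep_bref_of_laws_gen (hw : w ≠ 0) (hγ' : γ' = aE * κ₁ / w) (ha : a = aE ^ 2 / w)
    (hff : ∀ (x z : Fin (d + 1) → ℤ) (β β' : Fin (d + 1)), 𝕄 x z (Sum.inl β) (Sum.inl β') = w * mmRead N G x z (Sum.inl β) (Sum.inl β'))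
    (hBff : ∀ κ u κ' u' (x z : Fin (d + 1) → ℤ) (β β' : Fin (d + 1)), B κ u κ' u' x z (Sum.inl β) (Sum.inl β') = 0)
    (hRBff : ∀ κ u κ' u' (x z : Fin (d + 1) → ℤ) (β β' : Fin (d + 1)), RB κ u κ' u' x z (Sum.inl β) (Sum.inl β') = 0)
    (hVff : ∀ κ u (x z : Fin (d + 1) → ℤ) (β β' : Fin (d + 1)), Vbd κ u x z (Sum.inl β) (Sum.inl β') = 0)
    (hQ : ∀ κ u κ' u', mmRead N (Q₀ κ (bref α κ u) κ' (bref α κ' u')) = (reflSign α κ * reflSign α κ') • refK (Φ (d := d) L α)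
      (mmRead N (Q₀ κ u κ' u') +
        conjW (mmRead N G) (mmRead N (E₀ κ u)) (mmRead N (E₀ κ' u')) (diagK fun p c => κ₁ * cg κ u p c)
          (diagK fun p c => κ₁ * cg κ' u' p c) (diagK (hh κ u κ' u')) - mmRead N (R₀ κ u κ' u')))
    (hBfm : ∀ κ u κ' u' (x z : Fin (d + 1) → ℤ) (β m : Fin (d + 1)),
      (b • B κ (bref α κ u) κ' (bref α κ' u')) x z (Sum.inl β) (Sum.inr m) =
        ((reflSign α κ * reflSign α κ') • refK (Φ (d := d) L α) (b • B κ u κ' u' +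
          conjW 𝕄 (aE • mmRead N (E₀ κ u) + Vbd κ u) (aE • mmRead N (E₀ κ' u') + Vbd κ' u') (diagK fun p c => γ' * cg κ u p c)
            (diagK fun p c => γ' * cg κ' u' p c) (diagK (hB κ u κ' u')) + RB κ u κ' u')) x z (Sum.inl β) (Sum.inr m))
    (hBmf : ∀ κ u κ' u' (x z : Fin (d + 1) → ℤ) (m β : Fin (d + 1)),
      (b • B κ (bref α κ u) κ' (bref α κ' u')) x z (Sum.inr m) (Sum.inl β) =
        ((reflSign α κ * reflSign α κ') • refK (Φ (d := d) L α) (b • B κ u κ' u' +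
          conjW 𝕄 (aE • mmRead N (E₀ κ u) + Vbd κ u) (aE • mmRead N (E₀ κ' u') + Vbd κ' u') (diagK fun p c => γ' * cg κ u p c)
            (diagK fun p c => γ' * cg κ' u' p c) (diagK (hB κ u κ' u')) + RB κ u κ' u')) x z (Sum.inr m) (Sum.inl β))
    (hBmm : ∀ κ u κ' u' (x z : Fin (d + 1) → ℤ) (m m' : Fin (d + 1)),
      (b • B κ (bref α κ u) κ' (bref α κ' u')) x z (Sum.inr m) (Sum.inr m') =
        ((reflSign α κ * reflSign α κ') • refK (Φ (d := d) L α) (b • B κ u κ' u' +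
          conjW 𝕄 (aE • mmRead N (E₀ κ u) + Vbd κ u) (aE • mmRead N (E₀ κ' u') + Vbd κ' u') (diagK fun p c => γ' * cg κ u p c)
            (diagK fun p c => γ' * cg κ' u' p c) (diagK (hB κ u κ' u')) + RB κ u κ' u')) x z (Sum.inr m) (Sum.inr m'))
    (κ : Fin (d + 1)) (u : Fin (d + 1) → ℤ) (κ' : Fin (d + 1)) (u' : Fin (d + 1) → ℤ) :
    a • mmRead N (Q₀ κ (bref α κ u) κ' (bref α κ' u')) + b • B κ (bref α κ u) κ' (bref α κ' u') =
      (reflSign α κ * reflSign α κ') • refK (Φ (d := d) L α)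
        ((a • mmRead N (Q₀ κ u κ' u') + b • B κ u κ' u') +
          conjW 𝕄 (aE • mmRead N (E₀ κ u) + Vbd κ u) (aE • mmRead N (E₀ κ' u') + Vbd κ' u') (diagK fun p c => γ' * cg κ u p c)
            (diagK fun p c => γ' * cg κ' u' p c) (diagK (hB κ u κ' u')) +
          (-(a • mmRead N (R₀ κ u κ' u')) + RB κ u κ' u' +
            conjV (mmRead N G) (diagK fun p c => a * hh κ u κ' u' p c - w * hB κ u κ' u' p c))) := by
  subst hγ' ha
  funext x z e f
  rcases e with β | m <;> rcases f with β' | m'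
  · -- field–field: the `Q` sector carries the contact; the border sector, `Vbd` and `RB` vanish; the locks match the coefficients
    have hq := congrFun (congrFun (congrFun (congrFun (hQ κ u κ' u') x) z) (Sum.inl β)) (Sum.inl β')
    simp only [Pi.add_apply, Pi.sub_apply, Pi.neg_apply, Pi.smul_apply, smul_eq_mul, refK_apply, conjW_diag_apply, conjV_diagK_apply,
      hBff, hRBff, hVff, hff] at hq ⊢
    rw [hq]
    field_simp
    ring
  · -- field–multiplier: the border letter; `Q`, `R₀`, `mmRead N G` vanish
    have hb := hBfm κ u κ' u' x z β m'
    simp only [Pi.add_apply, Pi.neg_apply, Pi.smul_apply, smul_eq_mul, refK_apply, conjW_diag_apply, conjV_diagK_apply,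
      mmRead_inr_right, mul_zero, zero_mul, add_zero, zero_add] at hb ⊢
    rw [hb]
    ring
  · have hb := hBmf κ u κ' u' x z m β'
    simp only [Pi.add_apply, Pi.neg_apply, Pi.smul_apply, smul_eq_mul, refK_apply, conjW_diag_apply, conjV_diagK_apply,
      mmRead_inr_left, mul_zero, zero_mul, add_zero, zero_add] at hb ⊢
    rw [hb]
    ring
  · have hb := hBmm κ u κ' u' x z m m'
    simp only [Pi.add_apply, Pi.neg_apply, Pi.smul_apply, smul_eq_mul, refK_apply, conjW_diag_apply, conjV_diagK_apply,
      mmRead_inr_left, mul_zero, zero_mul, add_zero, zero_add] at hb ⊢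
    rw [hb]
    ring

end StepGen

/-! ## Junction: the comb's theorem is the instance `cg := ctGen d α L` -/

section Comb

variable {N L : ℕ} {𝕄 G : MKer (d + 1) (Fib d)} {w a aE b κ₁ γ' : ℝ} {α : Fin (d + 1)}
  {Q₀ R₀ B RB : Fin (d + 1) → (Fin (d + 1) → ℤ) → Fin (d + 1) → (Fin (d + 1) → ℤ) → MKer (d + 1) (Fib d)}
  {E₀ Vbd : Fin (d + 1) → (Fin (d + 1) → ℤ) → MKer (d + 1) (Fib d)}
  {hh hB : Fin (d + 1) → (Fin (d + 1) → ℤ) → Fin (d + 1) → (Fin (d + 1) → ℤ) → (Fin (d + 1) → ℤ) → Fib d → ℝ}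

/-- JUNCTION (an `example`, nothing re-declared): `SecondOrderStepLaw.quarticStep_bref_of_laws` is `quarticStep_bref_of_laws_gen` at `cg := ctGen d α L`. -/
example (hw : w ≠ 0) (hγ' : γ' = aE * κ₁ / w) (ha : a = aE ^ 2 / w)
    (hff : ∀ (x z : Fin (d + 1) → ℤ) (β β' : Fin (d + 1)), 𝕄 x z (Sum.inl β) (Sum.inl β') = w * mmRead N G x z (Sum.inl β) (Sum.inl β'))
    (hBff : ∀ κ u κ' u' (x z : Fin (d + 1) → ℤ) (β β' : Fin (d + 1)), B κ u κ' u' x z (Sum.inl β) (Sum.inl β') = 0)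
    (hRBff : ∀ κ u κ' u' (x z : Fin (d + 1) → ℤ) (β β' : Fin (d + 1)), RB κ u κ' u' x z (Sum.inl β) (Sum.inl β') = 0)
    (hVff : ∀ κ u (x z : Fin (d + 1) → ℤ) (β β' : Fin (d + 1)), Vbd κ u x z (Sum.inl β) (Sum.inl β') = 0)
    (hQ : ∀ κ u κ' u', mmRead N (Q₀ κ (bref α κ u) κ' (bref α κ' u')) = (reflSign α κ * reflSign α κ') • refK (Φ (d := d) L α)
      (mmRead N (Q₀ κ u κ' u') +
        conjW (mmRead N G) (mmRead N (E₀ κ u)) (mmRead N (E₀ κ' u')) (diagK fun p c => κ₁ * ctGen d α L κ u p c)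
          (diagK fun p c => κ₁ * ctGen d α L κ' u' p c) (diagK (hh κ u κ' u')) - mmRead N (R₀ κ u κ' u')))
    (hBfm : ∀ κ u κ' u' (x z : Fin (d + 1) → ℤ) (β m : Fin (d + 1)),
      (b • B κ (bref α κ u) κ' (bref α κ' u')) x z (Sum.inl β) (Sum.inr m) =
        ((reflSign α κ * reflSign α κ') • refK (Φ (d := d) L α) (b • B κ u κ' u' +
          conjW 𝕄 (aE • mmRead N (E₀ κ u) + Vbd κ u) (aE • mmRead N (E₀ κ' u') + Vbd κ' u') (diagK fun p c => γ' * ctGen d α L κ u p c)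
            (diagK fun p c => γ' * ctGen d α L κ' u' p c) (diagK (hB κ u κ' u')) + RB κ u κ' u')) x z (Sum.inl β) (Sum.inr m))
    (hBmf : ∀ κ u κ' u' (x z : Fin (d + 1) → ℤ) (m β : Fin (d + 1)),
      (b • B κ (bref α κ u) κ' (bref α κ' u')) x z (Sum.inr m) (Sum.inl β) =
        ((reflSign α κ * reflSign α κ') • refK (Φ (d := d) L α) (b • B κ u κ' u' +
          conjW 𝕄 (aE • mmRead N (E₀ κ u) + Vbd κ u) (aE • mmRead N (E₀ κ' u') + Vbd κ' u') (diagK fun p c => γ' * ctGen d α L κ u p c)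
            (diagK fun p c => γ' * ctGen d α L κ' u' p c) (diagK (hB κ u κ' u')) + RB κ u κ' u')) x z (Sum.inr m) (Sum.inl β))
    (hBmm : ∀ κ u κ' u' (x z : Fin (d + 1) → ℤ) (m m' : Fin (d + 1)),
      (b • B κ (bref α κ u) κ' (bref α κ' u')) x z (Sum.inr m) (Sum.inr m') =
        ((reflSign α κ * reflSign α κ') • refK (Φ (d := d) L α) (b • B κ u κ' u' +
          conjW 𝕄 (aE • mmRead N (E₀ κ u) + Vbd κ u) (aE • mmRead N (E₀ κ' u') + Vbd κ' u') (diagK fun p c => γ' * ctGen d α L κ u p c)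
            (diagK fun p c => γ' * ctGen d α L κ' u' p c) (diagK (hB κ u κ' u')) + RB κ u κ' u')) x z (Sum.inr m) (Sum.inr m'))
    (κ : Fin (d + 1)) (u : Fin (d + 1) → ℤ) (κ' : Fin (d + 1)) (u' : Fin (d + 1) → ℤ) :
    a • mmRead N (Q₀ κ (bref α κ u) κ' (bref α κ' u')) + b • B κ (bref α κ u) κ' (bref α κ' u') =
      (reflSign α κ * reflSign α κ') • refK (Φ (d := d) L α)
        ((a • mmRead N (Q₀ κ u κ' u') + b • B κ u κ' u') +
          conjW 𝕄 (aE • mmRead N (E₀ κ u) + Vbd κ u) (aE • mmRead N (E₀ κ' u') + Vbd κ' u') (diagK fun p c => γ' * ctGen d α L κ u p c)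
            (diagK fun p c => γ' * ctGen d α L κ' u' p c) (diagK (hB κ u κ' u')) +
          (-(a • mmRead N (R₀ κ u κ' u')) + RB κ u κ' u' +
            conjV (mmRead N G) (diagK fun p c => a * hh κ u κ' u' p c - w * hB κ u κ' u' p c))) :=
  quarticStep_bref_of_laws_gen (cg := ctGen d α L) hw hγ' ha hff hBff hRBff hVff hQ hBfm hBmf hBmm κ u κ' u'

end Comb

end

end Summit.QuantumFields.BalabanUV.Beta.SecondOrderStepLawGen
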